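import Mathlib
import Summits.Ventures.DiscreteObjects.Mahler.CyclotomicIntegerDescent

/-!
# Cyclotomic integers: Galois descent `ℤ[ζ_m] ∩ ℚ(ζ_m^p) = ℤ[ζ_m^p]`, explicitly (venture `DiscreteObjects`, target L)

Cell `pub-namedobj`, seat `pub-namedobj-mahler-g28`. Framing: lottery ticket; floor = certified bounds/negative ranges.

Infrastructure for the degenerate case of [cite: BombieriGubler2001, Theorem 4.4.9, Case II] (Amoroso–Dvornicich 2000,
"`ζ' α` lies in the cyclotomic subfield `ℚ(ζ_{m/p})`"), completing `CyclotomicIntegerDescent` (which did `p² ∣ m`):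
for `m = p n`, `p` an odd prime, in purely arithmetic form over `ℂ` —
* `exists_primitiveRoot_mod`: a primitive root modulo `p` (cyclicity of `(ℤ/p)ˣ`, Mathlib);
* `exists_galois_generator`: an exponent `k = 1 + n s`, `p ∤ s`, prime to `p n`, whose powers cover every `k' ≡ 1 (mod n)`
  prime to `p n` modulo `p n` (a generator of `Gal(ℚ(ζ_m)/ℚ(ζ_m^p))`: `k = 1 + n` if `p ∣ n`, CRT with a primitive root if
  `p ∤ n`);
* `aeval_pow_eq_of_invariant`: invariance of `g(ζ)` under `ζ ↦ ζ^k` gives invariance under the whole group (orbit argument);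
* `exists_descent_of_not_dvd` (`p ∤ n`, NEW explicit formula by a TWISTED trace): if `g(ζ^{1+nt}) = g(ζ)` for the
  `p - 1` conjugates, then `g(ζ) = g(ξ) − p ξ^{(n−1)(p−1)} (contract_p (g X^{p−1}))(ζ^p)` with `ξ = ζ^{1+nt₀}` the
  non-primitive translate (`p ∣ 1 + n t₀`), an integer polynomial in `ζ^p`;
* `exists_descent_of_invariant`: both cases — a `σ_k`-invariant cyclotomic integer `g(ζ_m)` is `G(ζ_m^p)`, `G ∈ ℤ[X]`.
Elementary (no relative integral bases); REPLICATION-grade infrastructure, no new mathematics claimed.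
-/

namespace Summit.Ventures.DiscreteObjects.Mahler

open Polynomial Finset

/-- **A primitive root modulo a prime.**  For a prime `p` there is `r`, `p ∤ r`, such that every natural number
prime to `p` is congruent to a power of `r` modulo `p` (cyclicity of `(ℤ/p)ˣ`). -/
theorem exists_primitiveRoot_mod {p : ℕ} (hp : p.Prime) :
    ∃ r : ℕ, ¬ p ∣ r ∧ ∀ x : ℕ, ¬ p ∣ x → ∃ e : ℕ, r ^ e ≡ x [MOD p] := by
  haveI : Fact p.Prime := ⟨hp⟩
  obtain ⟨γ, hγ⟩ := IsCyclic.exists_generator (α := (ZMod p)ˣ)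
  refine ⟨(γ : ZMod p).val, ?_, ?_⟩
  · rw [← ZMod.natCast_eq_zero_iff, ZMod.natCast_zmod_val]
    exact γ.ne_zero
  · intro x hx
    have hxcop : x.Coprime p := (Nat.coprime_comm.1 ((Nat.Prime.coprime_iff_not_dvd hp).2 hx))
    set u : (ZMod p)ˣ := ZMod.unitOfCoprime x hxcop with hu
    have hmem : u ∈ Submonoid.powers γ :=
      ((isOfFinOrder_of_finite γ).mem_powers_iff_mem_zpowers).2 (hγ u)
    obtain ⟨e, he⟩ := (Submonoid.mem_powers_iff _ _).1 hmem
    refine ⟨e, ?_⟩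
    rw [← ZMod.natCast_eq_natCast_iff, Nat.cast_pow, ZMod.natCast_zmod_val, ← ZMod.coe_unitOfCoprime x hxcop,
      ← hu, ← he, Units.val_pow_eq_pow_val]

/-- **A generator of `Gal(ℚ(ζ_{pn})/ℚ(ζ_n))` in arithmetic form.**  For an odd prime `p` and `n ≥ 1` there is
`k = 1 + n s` with `p ∤ s`, `k` prime to `p n`, such that every `k'` prime to `p n` with `k' ≡ 1 (mod n)` is
congruent to a power of `k` modulo `p n`.  (If `p ∣ n` take `s = 1`; if `p ∤ n` take `k ≡ r (mod p)` for a primitive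
root `r` mod `p`.) -/
theorem exists_galois_generator {p n : ℕ} (hp : p.Prime) (hp2 : 2 < p) (hn : 0 < n) :
    ∃ k s : ℕ, k = 1 + n * s ∧ ¬ p ∣ s ∧ k.Coprime (p * n) ∧
      ∀ k' : ℕ, k'.Coprime (p * n) → k' ≡ 1 [MOD n] → ∃ e : ℕ, k ^ e ≡ k' [MOD p * n] := by
  by_cases hpn : p ∣ n
  · -- `k = 1 + n`
    refine ⟨1 + n * 1, 1, rfl, ?_, ?_, ?_⟩
    · intro h; exact hp.one_lt.ne' (Nat.dvd_one.1 h)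
    · rw [mul_one]
      refine Nat.Coprime.mul_right ?_ ?_
      · refine (Nat.coprime_comm.1 ((Nat.Prime.coprime_iff_not_dvd hp).2 ?_))
        intro h
        have : p ∣ 1 := (Nat.dvd_add_right hpn).1 (by rwa [add_comm] at h)
        exact hp.one_lt.ne' (Nat.dvd_one.1 this)
      · rw [show 1 + n = 1 + 1 * n by ring, Nat.coprime_add_mul_right_left]
        exact Nat.coprime_one_left n
    · intro k' hk'cop hk'1
      rw [mul_one]
      have hk'pos : 1 ≤ k' := by
        rcases Nat.eq_zero_or_pos k' with h0 | h0
        · exfalso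
          rw [h0, Nat.coprime_zero_left] at hk'cop
          have : p * n ≥ 2 * 1 := Nat.mul_le_mul hp.two_le hn
          omega
        · exact h0
      have hdvd : n ∣ k' - 1 := (Nat.modEq_iff_dvd' hk'pos).1 hk'1.symm
      obtain ⟨t, ht⟩ := hdvd
      refine ⟨t, ?_⟩
      have hk' : k' = 1 + t * n := by rw [mul_comm t n]; omega
      have hN : p * n ∣ n * n := mul_dvd_mul hpn dvd_rfl
      have h := pow_one_add_pow_mod hN t
      rw [hk']
      exact h
  · -- `p ∤ n`: `k ≡ r (mod p)`, `k ≡ 1 (mod n)`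
    obtain ⟨r, hr, hgen⟩ := exists_primitiveRoot_mod hp
    have hncop : n.Coprime p := Nat.coprime_comm.1 ((Nat.Prime.coprime_iff_not_dvd hp).2 hpn)
    obtain ⟨s, -, hs⟩ := Nat.exists_mul_mod_eq_of_coprime (r + (p - 1)) hncop hp.ne_zero
    -- `n s ≡ r - 1 (mod p)`, so `k = 1 + n s ≡ r (mod p)`
    have hk : (1 + n * s) ≡ r [MOD p] := by
      have h1 : n * s ≡ r + (p - 1) [MOD p] := hs
      have h2 : 1 + n * s ≡ 1 + (r + (p - 1)) [MOD p] := h1.add_left 1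
      have h3 : 1 + (r + (p - 1)) = r + p := by omega
      rw [h3] at h2
      exact h2.trans (by unfold Nat.ModEq; rw [Nat.add_mod_right])
    refine ⟨1 + n * s, s, rfl, ?_, ?_, ?_⟩
    · intro hps
      -- then `k ≡ 1 (mod p)`, so `r ≡ 1`, so every unit is `≡ 1 (mod p)`: false for `2`
      have h1 : (1 + n * s) ≡ 1 [MOD p] := by
        have : n * s ≡ 0 [MOD p] := Nat.modEq_zero_iff_dvd.2 (dvd_mul_of_dvd_right hps n)
        have h := this.add_left 1
        rwa [add_zero] at h
      have hr1 : r ≡ 1 [MOD p] := hk.symm.trans h1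
      have h2 : ¬ p ∣ 2 := by
        intro h; have := Nat.le_of_dvd (by norm_num) h; omega
      obtain ⟨e, he⟩ := hgen 2 h2
      have h3 : r ^ e ≡ 1 [MOD p] := by
        have h := hr1.pow e
        rwa [one_pow] at h
      have h4 : 1 ≡ 2 [MOD p] := h3.symm.trans he
      have h5 : p ∣ 2 - 1 := (Nat.modEq_iff_dvd' (by norm_num)).1 h4
      exact hp.one_lt.ne' (Nat.dvd_one.1 (by simpa using h5))
    · refine Nat.Coprime.mul_right ?_ ?_
      · refine Nat.coprime_comm.1 ((Nat.Prime.coprime_iff_not_dvd hp).2 ?_)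
        intro h
        have h1 : (1 + n * s) ≡ 0 [MOD p] := Nat.modEq_zero_iff_dvd.2 h
        have h2 : r ≡ 0 [MOD p] := hk.symm.trans h1
        exact hr (Nat.modEq_zero_iff_dvd.1 h2)
      · rw [show 1 + n * s = 1 + s * n by ring, Nat.coprime_add_mul_right_left]
        exact Nat.coprime_one_left n
    · intro k' hk'cop hk'1
      have hk'p : ¬ p ∣ k' := by
        intro h
        have h1 : p ∣ Nat.gcd k' (p * n) := Nat.dvd_gcd h (dvd_mul_right p n)
        rw [hk'cop] at h1
        exact hp.one_lt.ne' (Nat.dvd_one.1 h1)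
      obtain ⟨e, he⟩ := hgen k' hk'p
      refine ⟨e, ?_⟩
      have hmodp : (1 + n * s) ^ e ≡ k' [MOD p] := (hk.pow e).trans he
      have hmodn : (1 + n * s) ^ e ≡ k' [MOD n] := by
        have h1 : (1 + n * s) ≡ 1 [MOD n] := by
          have : n * s ≡ 0 [MOD n] := Nat.modEq_zero_iff_dvd.2 (dvd_mul_right n s)
          have h := this.add_left 1
          rwa [add_zero] at h
        have h2 : (1 + n * s) ^ e ≡ 1 [MOD n] := by
          have h := h1.pow e
          rwa [one_pow] at h
        exact h2.trans hk'1.symm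
      exact (Nat.modEq_and_modEq_iff_modEq_mul hncop.symm).1 ⟨hmodp, hmodn⟩

/-- **The orbit argument.**  If `g(μ^k) = g(μ)` for every primitive `m`-th root of unity `μ` (`m = p n`), where `k`
generates in the sense of `exists_galois_generator`, then `g(ζ^{k'}) = g(ζ)` for every `k'` prime to `m` with
`k' ≡ 1 (mod n)` — i.e. `g(ζ)` is constant on the Galois orbit over `ℚ(ζ^p)`. -/
theorem aeval_pow_eq_of_invariant {m p n k : ℕ} (hm : m = p * n)
    (hgen : ∀ k' : ℕ, k'.Coprime (p * n) → k' ≡ 1 [MOD n] → ∃ e : ℕ, k ^ e ≡ k' [MOD p * n])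
    (hkcop : k.Coprime (p * n)) (g : ℤ[X]) {ζ : ℂ} (hζ : IsPrimitiveRoot ζ m)
    (hinv : ∀ μ : ℂ, IsPrimitiveRoot μ m → aeval (μ ^ k) g = aeval μ g)
    {k' : ℕ} (hk'cop : k'.Coprime m) (hk'1 : k' ≡ 1 [MOD n]) :
    aeval (ζ ^ k') g = aeval ζ g := by
  rw [hm] at hk'cop
  obtain ⟨e, he⟩ := hgen k' hk'cop hk'1
  have hiter : ∀ i : ℕ, aeval (ζ ^ k ^ i) g = aeval ζ g := by
    intro i
    induction i with
    | zero => simp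
    | succ i ih =>
      rw [pow_succ, pow_mul]
      rw [hinv _ (hζ.pow_of_coprime _ (by rw [hm]; exact Nat.Coprime.pow_left i hkcop))]
      exact ih
  have h1 : ζ ^ k' = ζ ^ k ^ e := by
    refine pow_eq_pow_of_mod_eq hζ.pow_eq_one ?_
    rw [hm]
    exact he.symm
  rw [h1]
  exact hiter e

/-- **Twisted trace descent (`p ∤ n`).**  Let `m = p n` with `p` prime, `p ∤ n`, `ζ` a primitive `m`-th root of
unity, `θ = ζ^p`, and `g ∈ ℤ[X]` such that `g(ζ^{1+nt}) = g(ζ)` for every `t < p` with `p ∤ 1 + n t` (the Galois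
conjugates of `ζ` over `ℚ(θ)`).  Let `t₀ < p` be the index with `p ∣ 1 + n t₀` and `ξ = ζ^{1+nt₀} = θ^{c₀}`,
`c₀ = (1 + n t₀)/p` (an `n`-th root of unity).  Then, EXPLICITLY,
`g(ζ) = g(ξ) − p · ξ^{(n−1)(p−1)} · (contract_p (g·X^{p−1}))(θ)`, an integer polynomial in `θ`:
`ℤ[ζ_m] ∩ ℚ(ζ_m^p) = ℤ[ζ_m^p]` made explicit by the trace identity `sum_aeval_mul_pow_eq` applied to `g·X^{p-1}`
(the twist `X^{p-1}` kills the invariant part, `∑_t (ζ ω^t)^{p-1} = 0`, and isolates the non-primitive translate `ξ`). -/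
theorem exists_descent_of_not_dvd {m p n : ℕ} (hm0 : 0 < m) (hp : p.Prime) (hm : m = p * n) (hn : 0 < n)
    (hpn : ¬ p ∣ n) (g : ℤ[X]) {ζ : ℂ} (hζ : IsPrimitiveRoot ζ m)
    (hconst : ∀ t : ℕ, t < p → ¬ p ∣ (1 + n * t) → aeval (ζ ^ (1 + n * t)) g = aeval ζ g) :
    ∃ G : ℤ[X], aeval ζ g = aeval (ζ ^ p) G := by
  have hncop : n.Coprime p := Nat.coprime_comm.1 ((Nat.Prime.coprime_iff_not_dvd hp).2 hpn)
  -- `ω = ζ^n`, a primitive `p`-th root of unity; `θ = ζ^p`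
  set ω : ℂ := ζ ^ n with hωdef
  have hω : IsPrimitiveRoot ω p := hζ.pow hm0 (by rw [hm, mul_comm])
  set θ : ℂ := ζ ^ p with hθdef
  -- the exceptional index `t₀`
  obtain ⟨t₀, ht₀p, ht₀⟩ := Nat.exists_mul_mod_eq_of_coprime (p - 1) hncop hp.ne_zero
  have hdvd₀ : p ∣ 1 + n * t₀ := by
    have h1 : n * t₀ ≡ p - 1 [MOD p] := ht₀
    have h2 : 1 + n * t₀ ≡ 1 + (p - 1) [MOD p] := h1.add_left 1
    rw [show 1 + (p - 1) = p by omega] at h2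
    exact Nat.modEq_zero_iff_dvd.1 (h2.trans (Nat.modEq_zero_iff_dvd.2 dvd_rfl))
  obtain ⟨c₀, hc₀⟩ := hdvd₀
  set ξ : ℂ := ζ ^ (1 + n * t₀) with hξdef
  have hξθ : ξ = θ ^ c₀ := by rw [hξdef, hc₀, pow_mul]
  have hξn : ξ ^ n = 1 := by
    rw [hξdef, ← pow_mul, hc₀, show p * c₀ * n = m * c₀ by rw [hm]; ring, pow_mul, hζ.pow_eq_one, one_pow]
  -- uniqueness of `t₀`
  have huniq : ∀ j : ℕ, j < p → j ≠ t₀ → ¬ p ∣ 1 + n * j := by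
    intro j hj hne hdj
    have h1 : 1 + n * j ≡ 1 + n * t₀ [MOD p] :=
      (Nat.modEq_zero_iff_dvd.2 hdj).trans (Nat.modEq_zero_iff_dvd.2 ⟨c₀, hc₀⟩).symm
    have h2 : n * j ≡ n * t₀ [MOD p] := Nat.ModEq.add_left_cancel' 1 h1
    have h3 : j ≡ t₀ [MOD p] := Nat.ModEq.cancel_left_of_coprime (by rw [Nat.gcd_comm]; exact hncop) h2
    exact hne (Nat.ModEq.eq_of_lt_of_lt h3 hj ht₀p)
  -- the trace identity for `f = g X^{p-1}`
  set f : ℤ[X] := g * X ^ (p - 1) with hf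
  have htr := sum_aeval_mul_pow_eq hp hω ζ f
  set γ : ℂ := aeval ζ g with hγ
  set δ : ℂ := aeval ξ g - γ with hδ
  have hζω : ∀ j : ℕ, ζ * ω ^ j = ζ ^ (1 + n * j) := by
    intro j; rw [pow_add, pow_one, hωdef, pow_mul]
  have hterm : ∀ j ∈ range p, aeval (ζ * ω ^ j) f =
      γ * (ζ ^ (1 + n * j)) ^ (p - 1) + (if j = t₀ then δ * ξ ^ (p - 1) else 0) := by
    intro j hj
    rw [Finset.mem_range] at hj
    rw [hf, map_mul, map_pow, aeval_X, hζω j]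
    by_cases hjt : j = t₀
    · rw [if_pos hjt, hjt, ← hξdef, hδ]; ring
    · rw [if_neg hjt, hconst j hj (huniq j hj hjt), add_zero]
  have hcopp : (p - 1).Coprime p :=
    (Nat.coprime_of_lt_prime (by have := hp.two_le; omega) (by have := hp.one_lt; omega) hp).symm
  have hgeom : ∑ j ∈ range p, (ζ ^ (1 + n * j)) ^ (p - 1) = 0 := by
    have h1 : ∀ j ∈ range p, (ζ ^ (1 + n * j)) ^ (p - 1) = ζ ^ (p - 1) * (ω ^ (p - 1)) ^ j := by
      intro j _
      rw [hωdef, ← pow_mul, ← pow_mul, ← pow_mul, ← pow_add]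
      congr 1; ring
    rw [Finset.sum_congr rfl h1, ← Finset.mul_sum, (hω.pow_of_coprime _ hcopp).geom_sum_eq_zero hp.one_lt, mul_zero]
  have ht₀mem : t₀ ∈ range p := Finset.mem_range.2 ht₀p
  rw [Finset.sum_congr rfl hterm, Finset.sum_add_distrib, ← Finset.mul_sum, hgeom, mul_zero, zero_add,
    Finset.sum_ite_eq' (range p) t₀ (fun _ => δ * ξ ^ (p - 1)), if_pos ht₀mem] at htr
  -- `δ ξ^{p-1} = p · (contract_p f)(θ)`; multiply by `ξ^{(n-1)(p-1)}`
  set N' : ℕ := (n - 1) * (p - 1) with hN'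
  have hξpow : ξ ^ (p - 1) * ξ ^ N' = 1 := by
    rw [← pow_add, hN', show p - 1 + (n - 1) * (p - 1) = n * (p - 1) by
      have h := Nat.sub_add_cancel hn; nlinarith [h], pow_mul, hξn, one_pow]
  have hδeq : δ = (p : ℂ) * aeval θ (contract p f) * ξ ^ N' := by
    have h := congrArg (fun z => z * ξ ^ N') htr
    rw [mul_assoc, hξpow, mul_one] at h
    exact h
  refine ⟨expand ℤ c₀ g - C (p : ℤ) * X ^ (c₀ * N') * contract p f, ?_⟩
  rw [map_sub, map_mul, map_mul, aeval_C, algebraMap_int_eq, eq_intCast, expand_aeval, map_pow, aeval_X,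
    pow_mul, ← hξθ]
  have hγeq : γ = aeval ξ g - δ := by rw [hδ]; ring
  rw [hγeq, hδeq]
  push_cast
  ring

/-- **Descent for invariant cyclotomic integers (both cases).**  Let `m = p n` (`p` prime), `k = 1 + n s` with `p ∤ s`, prime to `m`, generating in the sense of `exists_galois_generator`, and `g ∈ ℤ[X]`
with `g(μ^k) = g(μ)` for every primitive `m`-th root of unity `μ`.  Then `g(ζ) = G(ζ^p)` for an integer polynomial
`G` (`contract_p g` if `p ∣ n`, `CyclotomicIntegerDescent`; the twisted-trace polynomial if `p ∤ n`):
`ℤ[ζ_m]^{Gal(ℚ(ζ_m)/ℚ(ζ_m^p))} = ℤ[ζ_m^p]`, explicitly. -/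
theorem exists_descent_of_invariant {m p n k s : ℕ} (hm0 : 0 < m) (hp : p.Prime) (hm : m = p * n) (hn : 0 < n)
    (hk : k = 1 + n * s) (hs : ¬ p ∣ s) (hkcop : k.Coprime (p * n))
    (hgen : ∀ k' : ℕ, k'.Coprime (p * n) → k' ≡ 1 [MOD n] → ∃ e : ℕ, k ^ e ≡ k' [MOD p * n])
    (g : ℤ[X]) {ζ : ℂ} (hζ : IsPrimitiveRoot ζ m)
    (hinv : ∀ μ : ℂ, IsPrimitiveRoot μ m → aeval (μ ^ k) g = aeval μ g) :
    ∃ G : ℤ[X], aeval ζ g = aeval (ζ ^ p) G := by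
  by_cases hpn : p ∣ n
  · refine ⟨contract p g, ?_⟩
    refine aeval_eq_aeval_contract_of_invariant hm0 hp hm hpn hs g hζ ?_
    intro μ hμ
    rw [← hk]
    exact hinv μ hμ
  · refine exists_descent_of_not_dvd hm0 hp hm hn hpn g hζ ?_
    intro t ht hpt
    have hk'cop : (1 + n * t).Coprime m := by
      rw [hm]
      refine Nat.Coprime.mul_right ?_ ?_
      · exact Nat.coprime_comm.1 ((Nat.Prime.coprime_iff_not_dvd hp).2 hpt)
      · rw [show 1 + n * t = 1 + t * n by ring, Nat.coprime_add_mul_right_left]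
        exact Nat.coprime_one_left n
    have hk'1 : (1 + n * t) ≡ 1 [MOD n] := by
      have : n * t ≡ 0 [MOD n] := Nat.modEq_zero_iff_dvd.2 (dvd_mul_right n t)
      have h := this.add_left 1
      rwa [add_zero] at h
    exact aeval_pow_eq_of_invariant hm hgen hkcop g hζ hinv hk'cop hk'1

end Summit.Ventures.DiscreteObjects.Mahler
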